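import Summits.AtomisticToContinuum.HydrodynamicLimit.Theorems.PolynomialCompression.Negative.Energy
import Summits.AtomisticToContinuum.HydrodynamicLimit.Theorems.PolynomialCompression.Negative.SmoothPressure
import Summits.AtomisticToContinuum.HydrodynamicLimit.Theorems.DenseExcursion.Negative.Everywhere
import Literature.MathematicalPhysics.KineticTheory.HardSphereBBGKYLiouvilleFlow
import Literature.Analysis.FluidPDE.HardSphereMomentumConservation
import Literature.Analysis.FunctionSpaces.TorusConvolution

/-!
# `KineticClosure` (route InformationPercolationEngine): the CONSTANT-TEST-FUNCTION sector of its conclusion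
# follows from the exact conservation laws alone

Second helper for the support item `InformationPercolationEngine.KineticClosure` (stmt-AtomisticToContinuum-13482,
`ContactChaos → CollisionRate → LocalSecondLaw → DensityCap → HsEosLowDensity → DiluteSelfConsistency →
HydrodynamicLimit`), complementing `InformationPercolationEngineKineticClosureDensity.lean` (the density third of the
conclusion from `DensityCap`). The conclusion `HydrodynamicLimit` asks, at every `t < T` and for EVERY continuous test
function `χ`, for convergence in probability of the three empirical fields to `∫χρ(t)`, `∫χρu(t)`, `∫χE(t)`. This file
settles the sector `χ ≡ c` (constants) of all three components with NO kinetic theory and NO chaos hypothesis: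

* particles: on the good set of a hard-sphere flow the total momentum and the kinetic energy are invariant
  (`HardSphereFlow.configMomentum_flow`, `HardSphereFlow.configEnergy_flow`), the local Gibbs laws do not charge the
  bad set (`P_N ≪` Liouville), and the empirical momentum / energy fields of a constant test function are multiples of
  the total momentum / kinetic energy (`empiricalMomentumField_const`, `empiricalEnergyField_const`) — so the time-`t`
  deviation events coincide `P_N`-a.e. with the time-`0` ones (`localGibbsLaw_congr_good`);
* Euler: along a classical hard-sphere-Euler solution with a jointly smooth pressure field the total momentum
  `∫ ρu` is conserved (`integral_momentum_eq`: momentum equation + `∫ ∂ᵢ = 0`, `∫ ∇p = 0` on `𝕋³` + differentiation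
  under `∫` + one-sided mean value theorem; the energy twin is `PolynomialCompressionEnergy.integral_energy_eq`, mass
  needs no pressure hypothesis, `DenseExcursionEverywhere.integral_density_eq`); the smooth pressure field is what
  the EOS fact `HsEosLowDensity` plus a packing band `ρσ³ < η₀` buy
  (`PolynomialCompressionSmoothPressure.isSmoothSpaceTimeOn_pressure`);
* hence the `t = 0` tie transported: `tendsto_momentumField_const`, `tendsto_energyField_const` and their
  uniform-in-time twins `…_uniform` (per solution, given a smooth pressure field), `densityField_const_sub_eq_zero` (the density deviation of a constant
  is identically `0`), and the item-shaped corollary `constSector_of_eos_dilute`: `HsEosLowDensity` (stmt-0768,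
  verbatim body) → `DiluteSelfConsistency` (stmt-3091, verbatim body) → for all continuous positive profiles
  `∃ σ₀ > 0, ∀ σ ∈ (0, σ₀)`, every classical solution, every flow family and every `t = 0` tie, the three conjuncts of
  `TendstoHydroFieldsAt … t` hold at every `t ∈ [0,T)` for every constant `χ ≡ c`.

What remains of `KineticClosure` after this file and the density file is exactly the momentum and energy components
for NON-constant `χ` at `t > 0` — the local fluxes, i.e. the flux-closure / weak–strong content (see the item's notes).
prover-pitem-stmt-AtomisticToContinuum-13482-1.
-/

noncomputable section

namespace Summit.AtomisticToContinuum.HydrodynamicLimit.Theorems.KineticClosureConservation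

open MeasureTheory Filter Set Topology
open scoped ENNReal
open Literature.MathematicalPhysics.KineticTheory Literature.Analysis.FluidPDE
open Literature.Analysis.FunctionSpaces
open Summit.AtomisticToContinuum.HydrodynamicLimit.Theorems.DenseExcursionEverywhere
  (integral_density_eq integral_density_zero_eq_one)
open Summit.AtomisticToContinuum.HydrodynamicLimit.Theorems.PolynomialCompressionEnergy (integral_energy_eq)
open Summit.AtomisticToContinuum.HydrodynamicLimit.Theorems.PolynomialCompressionSmoothPressure
  (isSmoothSpaceTimeOn_pressure)

/-! ## §1 Empirical fields of constant test functions; transport of events along the flow -/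

/-- The empirical momentum field of the constant `c` is `N⁻¹ c · (total momentum)`. [folklore] -/
theorem empiricalMomentumField_const {N : ℕ} (z : Config N (Fin 3) T3) (c : ℝ) :
    empiricalMomentumField z (fun _ => c) = (N : ℝ)⁻¹ • c • configMomentum z := by
  simp only [empiricalMomentumField_eq_sum, configMomentum, Finset.smul_sum]

/-- The empirical energy field of the constant `c` is `N⁻¹ c · (kinetic energy)`. [folklore] -/
theorem empiricalEnergyField_const {N : ℕ} (z : Config N (Fin 3) T3) (c : ℝ) :
    empiricalEnergyField z (fun _ => c) = (N : ℝ)⁻¹ * (c * configEnergy z) := by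
  simp only [empiricalEnergyField_eq_sum, configEnergy, Finset.mul_sum]
  exact Finset.sum_congr rfl fun i _ => by ring

/-- The empirical density field of the constant `c` is `c` (for `N ≥ 1` particles). [folklore] -/
theorem empiricalDensityField_const {N : ℕ} (hN : N ≠ 0) (z : Config N (Fin 3) T3) (c : ℝ) :
    empiricalDensityField z (fun _ => c) = c := by
  have hN' : (N : ℝ) ≠ 0 := by exact_mod_cast hN
  rw [empiricalDensityField_eq_sum, Finset.sum_const, Finset.card_univ, Fintype.card_fin, nsmul_eq_mul,
    ← mul_assoc, inv_mul_cancel₀ hN', one_mul]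

/-- Along a hard-sphere flow, on the good set, the empirical momentum field of a constant is invariant (total
momentum is conserved, `HardSphereFlow.configMomentum_flow`). [folklore] -/
theorem empiricalMomentumField_flow_const {ε : ℝ} {N : ℕ} (Φ : HardSphereFlow (Torus.geometry (Fin 3)) ε N)
    {z : Config N (Fin 3) T3} (hz : z ∈ Φ.good) (t c : ℝ) :
    empiricalMomentumField (Φ.flow t z) (fun _ => c) = empiricalMomentumField z (fun _ => c) := by
  rw [empiricalMomentumField_const, empiricalMomentumField_const, Φ.configMomentum_flow hz t]

/-- Along a hard-sphere flow, on the good set, the empirical energy field of a constant is invariant (kinetic energy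
is conserved, `HardSphereFlow.configEnergy_flow`). [folklore] -/
theorem empiricalEnergyField_flow_const {ε : ℝ} {N : ℕ} (Φ : HardSphereFlow (Torus.geometry (Fin 3)) ε N)
    {z : Config N (Fin 3) T3} (hz : z ∈ Φ.good) (t c : ℝ) :
    empiricalEnergyField (Φ.flow t z) (fun _ => c) = empiricalEnergyField z (fun _ => c) := by
  rw [empiricalEnergyField_const, empiricalEnergyField_const, Φ.configEnergy_flow hz t]

/-- **Events that agree on the good set have the same local-Gibbs probability**: the local Gibbs law is absolutely
continuous with respect to the Liouville measure, which does not charge the complement of the good set. [folklore] -/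
theorem localGibbsLaw_congr_good {σ : ℝ} {a₀ θ₀ : T3 → ℝ} {u₀ : T3 → V3} {N : ℕ}
    (Φ : HardSphereFlow (Torus.geometry (Fin 3)) (hsDiameter σ N) (N + 1))
    {A B : Set (Config (N + 1) (Fin 3) T3)} (h : ∀ z ∈ Φ.good, z ∈ A ↔ z ∈ B) :
    localGibbsLaw σ a₀ u₀ θ₀ N Φ A = localGibbsLaw σ a₀ u₀ θ₀ N Φ B := by
  rw [localGibbsLaw_eq]
  refine measure_congr ?_
  have hgood : ∀ᵐ z ∂localGibbsMeasure σ a₀ u₀ θ₀ N, z ∈ Φ.good :=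
    (localGibbsMeasure_absolutelyContinuous σ a₀ u₀ θ₀ N Φ).ae_le Φ.ae_mem_good
  filter_upwards [hgood] with z hz
  simp only [eq_iff_iff]
  exact h z hz

/-! ## §2 Total momentum is conserved along classical solutions with a smooth pressure field -/

/-- **MOMENTUM IS CONSERVED** along a classical hard-sphere-Euler solution whose pressure field is jointly smooth:
`∫ ρu(t) = ∫ ρu(0)` for `t ∈ [0, T)` (momentum equation integrated over `𝕋³`: `∫ ∂ᵢ(ρuᵢu) = 0` and `∫ ∇p = 0`;
differentiation under `∫`; one-sided mean value theorem). The smooth-pressure hypothesis is the one of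
`PolynomialCompressionEnergy.integral_energy_eq` (supplied by `HsEosLowDensity` on a packing band). [folklore] -/
theorem integral_momentum_eq {σ T : ℝ} {ρ θ : ℝ → T3 → ℝ} {u : ℝ → T3 → V3} (hE : IsHardSphereEulerSolution σ T ρ u θ)
    (hp : Torus.IsSmoothSpaceTimeOn (Ico 0 T) (fun t y => hsPressure σ (ρ t y) (θ t y))) {t : ℝ} (ht : t ∈ Ico 0 T) :
    ∫ x, ρ t x • u t x = ∫ x, ρ 0 x • u 0 x := by
  have hM : Torus.IsSmoothSpaceTimeOn (Ico 0 T) (fun s y => ρ s y • u s y) :=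
    hE.smooth_density.smul hE.smooth_velocity
  have hF : ∀ i : Fin 3, Torus.IsSmoothSpaceTimeOn (Ico 0 T) (fun s y => (ρ s y * u s y i) • u s y) := fun i =>
    (hE.smooth_density.mul (hE.smooth_velocity.apply i)).smul hE.smooth_velocity
  have hderiv : ∀ s ∈ Ico 0 T, HasDerivWithinAt (fun s => ∫ x, ρ s x • u s x) 0 (Ico 0 T) s := by
    intro s hs
    have h1 := hM.hasDerivWithinAt_integral (convex_Ico 0 T) hs
    have h2 : ∫ x, Torus.timeDerivWithin (Ico 0 T) (fun s y => ρ s y • u s y) s x = 0 := by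
      have hpt : (fun x => Torus.timeDerivWithin (Ico 0 T) (fun s y => ρ s y • u s y) s x) =
          fun x => -((∑ i, Torus.partialDeriv i (fun y => (ρ s y * u s y i) • u s y) x) +
            Torus.gradient (fun y => hsPressure σ (ρ s y) (θ s y)) x) := by
        funext x
        have h := hE.momentum s hs x
        rw [add_assoc] at h
        exact eq_neg_of_add_eq_zero_left h
      have hint : ∀ i : Fin 3, Integrable (fun x => Torus.partialDeriv i (fun y => (ρ s y * u s y i) • u s y) x)
          volume := fun i => (((hF i).isSmooth_slice hs).partialDeriv i).integrable
      rw [hpt, integral_neg, neg_eq_zero, integral_add (integrable_finsetSum _ fun i _ => hint i)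
        (hp.isSmooth_slice hs).gradient.integrable, integral_finsetSum _ fun i _ => hint i,
        Torus.integral_gradient_eq_zero (hp.isSmooth_slice hs), add_zero]
      exact Finset.sum_eq_zero fun i _ => Torus.integral_partialDeriv_eq_zero_holds ((hF i).isSmooth_slice hs) i
    rwa [h2] at h1
  have hcont : ContinuousOn (fun s => ∫ x, ρ s x • u s x) (Icc 0 t) := fun s hs =>
    ((hderiv s ⟨hs.1, hs.2.trans_lt ht.2⟩).continuousWithinAt).mono (Icc_subset_Ico_right ht.2)
  have hright : ∀ s ∈ Ico 0 t, HasDerivWithinAt (fun s => ∫ x, ρ s x • u s x) 0 (Ici s) s := by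
    intro s hs
    have hsT : s ∈ Ico 0 T := ⟨hs.1, hs.2.trans ht.2⟩
    refine (hderiv s hsT).mono_of_mem_nhdsWithin ?_
    exact Filter.mem_of_superset (Ico_mem_nhdsGE hsT.2) (Ico_subset_Ico_left hsT.1)
  exact constant_of_has_deriv_right_zero hcont hright t (right_mem_Icc.2 ht.1)

/-! ## §3 The constant sector of the hydrodynamic fields at positive times -/

section PerSolution

variable {σ T : ℝ} {a₀ θ₀ : T3 → ℝ} {u₀ : T3 → V3} {ρ θ : ℝ → T3 → ℝ} {u : ℝ → T3 → V3}

/-- **Momentum, constant test functions.** Along a classical solution with a jointly smooth pressure field, for every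
flow family and every `t = 0` tie, at every `t ∈ [0,T)` the empirical MOMENTUM field of a constant `χ ≡ c` converges in
probability to `∫ cρu(t)`: the deviation event at time `t` is, on the good set, the deviation event at time `0`
(conservation on both sides), whose probability tends to `0` by the tie. [folklore] -/
theorem tendsto_momentumField_const (hE : IsHardSphereEulerSolution σ T ρ u θ)
    (hp : Torus.IsSmoothSpaceTimeOn (Ico 0 T) (fun t y => hsPressure σ (ρ t y) (θ t y)))
    (Φ : (N : ℕ) → HardSphereFlow (Torus.geometry (Fin 3)) (hsDiameter σ N) (N + 1))
    (hA : TendstoHydroFieldsAt (fun N => localGibbsLaw σ a₀ u₀ θ₀ N (Φ N)) Φ ρ u θ 0)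
    {t : ℝ} (ht : t ∈ Ico 0 T) (c : ℝ) {δ : ℝ} (hδ : 0 < δ) :
    Tendsto (fun N => localGibbsLaw σ a₀ u₀ θ₀ N (Φ N)
      {z | δ < ‖empiricalMomentumField ((Φ N).flow t z) (fun _ => c) - ∫ x, (c * ρ t x) • u t x‖}) atTop (𝓝 0) := by
  have h0 := (hA (fun _ => c) continuous_const δ hδ).2.1
  have hI : ∫ x, (c * ρ t x) • u t x = ∫ x, (c * ρ 0 x) • u 0 x := by
    simp_rw [mul_smul]
    rw [integral_smul, integral_smul, integral_momentum_eq hE hp ht]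
  have hev : ∀ N : ℕ, localGibbsLaw σ a₀ u₀ θ₀ N (Φ N)
      {z | δ < ‖empiricalMomentumField ((Φ N).flow t z) (fun _ => c) - ∫ x, (c * ρ t x) • u t x‖} =
      localGibbsLaw σ a₀ u₀ θ₀ N (Φ N)
      {z | δ < ‖empiricalMomentumField ((Φ N).flow 0 z) (fun _ => c) - ∫ x, (c * ρ 0 x) • u 0 x‖} := by
    intro N
    refine localGibbsLaw_congr_good (Φ N) fun z hz => ?_
    simp only [mem_setOf_eq]
    rw [empiricalMomentumField_flow_const (Φ N) hz, empiricalMomentumField_flow_const (Φ N) hz, hI]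
  simp_rw [hev]
  exact h0

/-- **Energy, constant test functions.** Same frame: at every `t ∈ [0,T)` the empirical ENERGY field of a constant
`χ ≡ c` converges in probability to `∫ cE(t)` (kinetic energy conserved on the good set; total energy of the classical
solution conserved, `integral_energy_eq`). [folklore] -/
theorem tendsto_energyField_const (hE : IsHardSphereEulerSolution σ T ρ u θ)
    (hp : Torus.IsSmoothSpaceTimeOn (Ico 0 T) (fun t y => hsPressure σ (ρ t y) (θ t y)))
    (Φ : (N : ℕ) → HardSphereFlow (Torus.geometry (Fin 3)) (hsDiameter σ N) (N + 1))
    (hA : TendstoHydroFieldsAt (fun N => localGibbsLaw σ a₀ u₀ θ₀ N (Φ N)) Φ ρ u θ 0)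
    {t : ℝ} (ht : t ∈ Ico 0 T) (c : ℝ) {δ : ℝ} (hδ : 0 < δ) :
    Tendsto (fun N => localGibbsLaw σ a₀ u₀ θ₀ N (Φ N)
      {z | δ < |empiricalEnergyField ((Φ N).flow t z) (fun _ => c) -
        ∫ x, c * totalEnergyDensity (ρ t x) (u t x) (θ t x)|}) atTop (𝓝 0) := by
  have h0 := (hA (fun _ => c) continuous_const δ hδ).2.2
  have hI : ∫ x, c * totalEnergyDensity (ρ t x) (u t x) (θ t x) =
      ∫ x, c * totalEnergyDensity (ρ 0 x) (u 0 x) (θ 0 x) := by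
    rw [integral_const_mul, integral_const_mul, integral_energy_eq hE hp ht]
  have hev : ∀ N : ℕ, localGibbsLaw σ a₀ u₀ θ₀ N (Φ N)
      {z | δ < |empiricalEnergyField ((Φ N).flow t z) (fun _ => c) -
        ∫ x, c * totalEnergyDensity (ρ t x) (u t x) (θ t x)|} =
      localGibbsLaw σ a₀ u₀ θ₀ N (Φ N)
      {z | δ < |empiricalEnergyField ((Φ N).flow 0 z) (fun _ => c) -
        ∫ x, c * totalEnergyDensity (ρ 0 x) (u 0 x) (θ 0 x)|} := by
    intro N
    refine localGibbsLaw_congr_good (Φ N) fun z hz => ?_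
    simp only [mem_setOf_eq]
    rw [empiricalEnergyField_flow_const (Φ N) hz, empiricalEnergyField_flow_const (Φ N) hz, hI]
  simp_rw [hev]
  exact h0

/-- **Momentum, constant test functions, uniformly in time**: the deviation is small SIMULTANEOUSLY at all
`s ∈ [0, t]` with probability `→ 1` (on the good set the time-`s` deviation IS the time-`0` deviation for every `s`).
[folklore] -/
theorem tendsto_momentumField_const_uniform (hE : IsHardSphereEulerSolution σ T ρ u θ)
    (hp : Torus.IsSmoothSpaceTimeOn (Ico 0 T) (fun t y => hsPressure σ (ρ t y) (θ t y)))
    (Φ : (N : ℕ) → HardSphereFlow (Torus.geometry (Fin 3)) (hsDiameter σ N) (N + 1))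
    (hA : TendstoHydroFieldsAt (fun N => localGibbsLaw σ a₀ u₀ θ₀ N (Φ N)) Φ ρ u θ 0)
    {t : ℝ} (ht : t ∈ Ico 0 T) (c : ℝ) {δ : ℝ} (hδ : 0 < δ) :
    Tendsto (fun N => localGibbsLaw σ a₀ u₀ θ₀ N (Φ N)
      {z | ∃ s ∈ Icc 0 t, δ < ‖empiricalMomentumField ((Φ N).flow s z) (fun _ => c) - ∫ x, (c * ρ s x) • u s x‖})
      atTop (𝓝 0) := by
  have h0 := (hA (fun _ => c) continuous_const δ hδ).2.1
  have hI : ∀ s ∈ Ico 0 T, ∫ x, (c * ρ s x) • u s x = ∫ x, (c * ρ 0 x) • u 0 x := fun s hs => by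
    simp_rw [mul_smul]
    rw [integral_smul, integral_smul, integral_momentum_eq hE hp hs]
  have hev : ∀ N : ℕ, localGibbsLaw σ a₀ u₀ θ₀ N (Φ N)
      {z | ∃ s ∈ Icc 0 t, δ < ‖empiricalMomentumField ((Φ N).flow s z) (fun _ => c) - ∫ x, (c * ρ s x) • u s x‖} =
      localGibbsLaw σ a₀ u₀ θ₀ N (Φ N)
      {z | δ < ‖empiricalMomentumField ((Φ N).flow 0 z) (fun _ => c) - ∫ x, (c * ρ 0 x) • u 0 x‖} := by
    intro N
    refine localGibbsLaw_congr_good (Φ N) fun z hz => ?_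
    simp only [mem_setOf_eq]
    constructor
    · rintro ⟨s, hs, h⟩
      rwa [empiricalMomentumField_flow_const (Φ N) hz, ← empiricalMomentumField_flow_const (Φ N) hz 0 c,
        hI s ⟨hs.1, hs.2.trans_lt ht.2⟩] at h
    · intro h
      refine ⟨0, ⟨le_rfl, ht.1⟩, ?_⟩
      rwa [hI 0 ⟨le_rfl, ht.1.trans_lt ht.2⟩]
  simp_rw [hev]
  exact h0

/-- **Energy, constant test functions, uniformly in time** (same mechanism). [folklore] -/
theorem tendsto_energyField_const_uniform (hE : IsHardSphereEulerSolution σ T ρ u θ)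
    (hp : Torus.IsSmoothSpaceTimeOn (Ico 0 T) (fun t y => hsPressure σ (ρ t y) (θ t y)))
    (Φ : (N : ℕ) → HardSphereFlow (Torus.geometry (Fin 3)) (hsDiameter σ N) (N + 1))
    (hA : TendstoHydroFieldsAt (fun N => localGibbsLaw σ a₀ u₀ θ₀ N (Φ N)) Φ ρ u θ 0)
    {t : ℝ} (ht : t ∈ Ico 0 T) (c : ℝ) {δ : ℝ} (hδ : 0 < δ) :
    Tendsto (fun N => localGibbsLaw σ a₀ u₀ θ₀ N (Φ N)
      {z | ∃ s ∈ Icc 0 t, δ < |empiricalEnergyField ((Φ N).flow s z) (fun _ => c) -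
        ∫ x, c * totalEnergyDensity (ρ s x) (u s x) (θ s x)|}) atTop (𝓝 0) := by
  have h0 := (hA (fun _ => c) continuous_const δ hδ).2.2
  have hI : ∀ s ∈ Ico 0 T, ∫ x, c * totalEnergyDensity (ρ s x) (u s x) (θ s x) =
      ∫ x, c * totalEnergyDensity (ρ 0 x) (u 0 x) (θ 0 x) := fun s hs => by
    rw [integral_const_mul, integral_const_mul, integral_energy_eq hE hp hs]
  have hev : ∀ N : ℕ, localGibbsLaw σ a₀ u₀ θ₀ N (Φ N)
      {z | ∃ s ∈ Icc 0 t, δ < |empiricalEnergyField ((Φ N).flow s z) (fun _ => c) -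
        ∫ x, c * totalEnergyDensity (ρ s x) (u s x) (θ s x)|} =
      localGibbsLaw σ a₀ u₀ θ₀ N (Φ N)
      {z | δ < |empiricalEnergyField ((Φ N).flow 0 z) (fun _ => c) -
        ∫ x, c * totalEnergyDensity (ρ 0 x) (u 0 x) (θ 0 x)|} := by
    intro N
    refine localGibbsLaw_congr_good (Φ N) fun z hz => ?_
    simp only [mem_setOf_eq]
    constructor
    · rintro ⟨s, hs, h⟩
      rwa [empiricalEnergyField_flow_const (Φ N) hz, ← empiricalEnergyField_flow_const (Φ N) hz 0 c,
        hI s ⟨hs.1, hs.2.trans_lt ht.2⟩] at h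
    · intro h
      refine ⟨0, ⟨le_rfl, ht.1⟩, ?_⟩
      rwa [hI 0 ⟨le_rfl, ht.1.trans_lt ht.2⟩]
  simp_rw [hev]
  exact h0

/-- **Density, constant test functions**: the deviation is IDENTICALLY ZERO at every `t ∈ [0,T)` and every `N` — the
empirical density field of `χ ≡ c` is `c` and `∫ cρ(t) = c` (mass conservation + admissible mass one, `σ ≤ 1/2`).
[folklore] -/
theorem densityField_const_sub_eq_zero (hσ2 : σ ≤ 1 / 2) (ha : Continuous a₀) (hθ : Continuous θ₀)
    (hu : Continuous u₀) (ha0 : ∀ x, 0 < a₀ x) (hθ0 : ∀ x, 0 < θ₀ x) (hE : IsHardSphereEulerSolution σ T ρ u θ)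
    (Φ : (N : ℕ) → HardSphereFlow (Torus.geometry (Fin 3)) (hsDiameter σ N) (N + 1))
    (hA : TendstoHydroFieldsAt (fun N => localGibbsLaw σ a₀ u₀ θ₀ N (Φ N)) Φ ρ u θ 0)
    {t : ℝ} (ht : t ∈ Ico 0 T) (c : ℝ) (N : ℕ) (z : Config (N + 1) (Fin 3) T3) :
    empiricalDensityField ((Φ N).flow t z) (fun _ => c) - ∫ x, c * ρ t x = 0 := by
  rw [empiricalDensityField_const (Nat.succ_ne_zero N), integral_const_mul, integral_density_eq hE ht,
    integral_density_zero_eq_one hσ2 ha hθ hu ha0 hθ0 Φ hA, mul_one, sub_self]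

/-- Density, constant test functions, in the `Tendsto` form of `TendstoHydroFieldsAt` (the event is empty). [folklore] -/
theorem tendsto_densityField_const (hσ2 : σ ≤ 1 / 2) (ha : Continuous a₀) (hθ : Continuous θ₀)
    (hu : Continuous u₀) (ha0 : ∀ x, 0 < a₀ x) (hθ0 : ∀ x, 0 < θ₀ x) (hE : IsHardSphereEulerSolution σ T ρ u θ)
    (Φ : (N : ℕ) → HardSphereFlow (Torus.geometry (Fin 3)) (hsDiameter σ N) (N + 1))
    (hA : TendstoHydroFieldsAt (fun N => localGibbsLaw σ a₀ u₀ θ₀ N (Φ N)) Φ ρ u θ 0)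
    {t : ℝ} (ht : t ∈ Ico 0 T) (c : ℝ) {δ : ℝ} (hδ : 0 < δ) :
    Tendsto (fun N => localGibbsLaw σ a₀ u₀ θ₀ N (Φ N)
      {z | δ < |empiricalDensityField ((Φ N).flow t z) (fun _ => c) - ∫ x, c * ρ t x|}) atTop (𝓝 0) := by
  have hev : ∀ N : ℕ, {z : Config (N + 1) (Fin 3) T3 |
      δ < |empiricalDensityField ((Φ N).flow t z) (fun _ => c) - ∫ x, c * ρ t x|} = ∅ := by
    intro N
    refine eq_empty_of_forall_notMem fun z hz => ?_
    rw [mem_setOf_eq, densityField_const_sub_eq_zero hσ2 ha hθ hu ha0 hθ0 hE Φ hA ht c N z, abs_zero] at hz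
    exact lt_irrefl _ (hδ.trans hz)
  simp_rw [hev, measure_empty]
  exact tendsto_const_nhds

end PerSolution

/-! ## §4 The item-shaped corollary: EOS fact + diluteness ⟹ the constant sector of `KineticClosure`'s conclusion -/

/-- **The constant sector of `KineticClosure`'s conclusion from the EOS fact and diluteness alone.** Assume the
hard-sphere EOS fact (stmt-AtomisticToContinuum-0768, verbatim body of `HsEosLowDensity`) and dilute self-consistency
(stmt-AtomisticToContinuum-3091, verbatim body of `DiluteSelfConsistency`). Then for all continuous positive profiles
there is `σ₀ > 0` such that for `0 < σ < σ₀`, every classical hard-sphere-Euler solution on `[0,T)`, every flow family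
and every `t = 0` tie, at every `t ∈ [0,T)` and for every CONSTANT test function `χ ≡ c` the three conjuncts of
`TendstoHydroFieldsAt … t` hold (density, momentum, energy). (`σ₀ := min (1/2) σ₀(3091 at η := η₀(0768))`; diluteness
keeps the packing in the analytic band, so the pressure field is smooth and §3 applies.) Neither `ContactChaos`,
`CollisionRate`, `LocalSecondLaw` nor `DensityCap` is used: what they must supply is the NON-constant sector. [folklore] -/
theorem constSector_of_eos_dilute
    (hEos : ∃ η₀ : ℝ, 0 < η₀ ∧ ∃ F : ℝ → ℝ, AnalyticOnNhd ℝ F (Set.Ioo (-η₀) η₀) ∧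
      Set.EqOn Literature.MathematicalPhysics.KineticTheory.hsExcessFreeEnergy F (Set.Ico 0 η₀) ∧ F 0 = 0 ∧
      deriv F 0 = 2 * Real.pi / 3 ∧ ∀ η ∈ Set.Ico 0 η₀, Filter.Tendsto (fun N : ℕ => -(N : ℝ)⁻¹ *
        Real.log (Literature.MathematicalPhysics.KineticTheory.hsFreeVolume η N)) Filter.atTop (nhds (F η)))
    (hDS : ∀ η : ℝ, 0 < η → ∀ (a₀ θ₀ : T3 → ℝ) (u₀ : T3 → V3), Continuous a₀ → Continuous θ₀ → Continuous u₀ →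
      (∀ x, 0 < a₀ x) → (∀ x, 0 < θ₀ x) → ∃ σ₀ : ℝ, 0 < σ₀ ∧ ∀ σ : ℝ, 0 < σ → σ < σ₀ →
      ∀ (T : ℝ) (ρ θ : ℝ → T3 → ℝ) (u : ℝ → T3 → V3), IsHardSphereEulerSolution σ T ρ u θ →
        ∀ Φ : (N : ℕ) → HardSphereFlow (Torus.geometry (Fin 3)) (hsDiameter σ N) (N + 1),
          TendstoHydroFieldsAt (fun N => localGibbsLaw σ a₀ u₀ θ₀ N (Φ N)) Φ ρ u θ 0 →
            ∀ t ∈ Set.Ico 0 T, ∀ x, ρ t x * σ ^ 3 < η)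
    (a₀ θ₀ : T3 → ℝ) (u₀ : T3 → V3) (ha : Continuous a₀) (hθ : Continuous θ₀) (hu : Continuous u₀)
    (ha0 : ∀ x, 0 < a₀ x) (hθ0 : ∀ x, 0 < θ₀ x) :
    ∃ σ₀ : ℝ, 0 < σ₀ ∧ ∀ σ : ℝ, 0 < σ → σ < σ₀ →
      ∀ (T : ℝ) (ρ θ : ℝ → T3 → ℝ) (u : ℝ → T3 → V3), IsHardSphereEulerSolution σ T ρ u θ →
        ∀ Φ : (N : ℕ) → HardSphereFlow (Torus.geometry (Fin 3)) (hsDiameter σ N) (N + 1),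
          TendstoHydroFieldsAt (fun N => localGibbsLaw σ a₀ u₀ θ₀ N (Φ N)) Φ ρ u θ 0 →
            ∀ t ∈ Ico 0 T, ∀ c : ℝ, ∀ δ > (0 : ℝ),
              Tendsto (fun N => localGibbsLaw σ a₀ u₀ θ₀ N (Φ N)
                {z | δ < |empiricalDensityField ((Φ N).flow t z) (fun _ => c) - ∫ x, c * ρ t x|}) atTop (𝓝 0) ∧
              Tendsto (fun N => localGibbsLaw σ a₀ u₀ θ₀ N (Φ N)
                {z | δ < ‖empiricalMomentumField ((Φ N).flow t z) (fun _ => c) - ∫ x, (c * ρ t x) • u t x‖})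
                atTop (𝓝 0) ∧
              Tendsto (fun N => localGibbsLaw σ a₀ u₀ θ₀ N (Φ N)
                {z | δ < |empiricalEnergyField ((Φ N).flow t z) (fun _ => c) -
                  ∫ x, c * totalEnergyDensity (ρ t x) (u t x) (θ t x)|}) atTop (𝓝 0) := by
  obtain ⟨η₀, hη₀, Hp⟩ := isSmoothSpaceTimeOn_pressure hEos
  obtain ⟨σ₁, hσ₁, H⟩ := hDS η₀ hη₀ a₀ θ₀ u₀ ha hθ hu ha0 hθ0
  refine ⟨min (1 / 2) σ₁, lt_min (by norm_num) hσ₁, fun σ hσ hσlt T ρ θ u hE Φ hA t ht c δ hδ => ?_⟩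
  have hσ2 : σ ≤ 1 / 2 := (hσlt.trans_le (min_le_left _ _)).le
  have hσ₁' : σ < σ₁ := hσlt.trans_le (min_le_right _ _)
  have hp : Torus.IsSmoothSpaceTimeOn (Ico 0 T) (fun t y => hsPressure σ (ρ t y) (θ t y)) :=
    Hp σ T ρ θ u hσ hE (H σ hσ hσ₁' T ρ θ u hE Φ hA)
  exact ⟨tendsto_densityField_const hσ2 ha hθ hu ha0 hθ0 hE Φ hA ht c hδ,
    tendsto_momentumField_const hE hp Φ hA ht c hδ, tendsto_energyField_const hE hp Φ hA ht c hδ⟩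

end Summit.AtomisticToContinuum.HydrodynamicLimit.Theorems.KineticClosureConservation

end
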